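import Mathlib.Algebra.BigOperators.Module
import Mathlib.Algebra.Order.BigOperators.Group.Finset
import Mathlib.Algebra.BigOperators.Fin
import Mathlib.Analysis.Convex.Extreme
import Mathlib.Data.Real.Basic
import Mathlib.GroupTheory.Perm.Basic
import Mathlib.Tactic.Linarith
import Mathlib.Tactic.LinearCombination
import Mathlib.Tactic.Positivity
import HarnessLib

/-!
# The Fujishige–Tomizawa vertex of a generalized permutahedron (Borinsky, AIHPD 2023 = arXiv:2008.12310, §6.1: Theorem 23's facet presentation `𝒢_z`, Lemma 26) — PROVED: for a supermodular `z` with `z(∅) = 0` and a permutation `σ`, the vector `w^{(σ,z)}_{σ(k)} = z(A^σ_k) − z(A^σ_{k−1})` lies in `𝒢_z`, has `Σ_{i∈A^σ_k} w_i = z(A^σ_k)` on the chain sets, maximises every linear functional `y` of the Weyl chamber `y_{σ(1)} ≤ ⋯ ≤ y_{σ(n)}` over `𝒢_z`, and is an extreme point of `𝒢_z`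

Source [Borinsky2020]: M. Borinsky, "Tropical Monte Carlo quadrature for Feynman integrals", Ann. Inst. Henri Poincaré D 10
(2023) 635–685 = arXiv:2008.12310v2; e-print `tropical.tex` (deposited on the pub-qed HOME under `data/lit/sources/.cache/2008.12310/`;
theorem numbering = the e-print's flat counter, as in the companion files `TropicalApproximation` / `SectorTableRecursion`), VERBATIM
(tex l.1004–1057):
"The cones of maximal dimension in the reduced normal fan 𝓕_{Π_n}/𝟙ℝ of Π_n are labelled by permutations as well. They are of the form,
C_σ = { y ∈ ℝⁿ/𝟙ℝ : y_{σ(1)} ≤ … ≤ y_{σ(n)} } (38) such a domain is called a Weyl chamber." · "**Definition 22** (Generalized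
permutahedron [Postnikov, Definition 6.1]). A polytope whose normal fan is a coarsening of 𝓕_{Π_n} is a generalized permutahedron." ·
"**Theorem 23** ([Postnikov, Definition 6.1] and [Aguiar–Ardila, Theorem 12.3]). A generalized permutahedron 𝒢_z has the facet
presentation 𝒢_z = { v ∈ ℝⁿ : Σ_{i∈[n]} v_i = z([n]) and Σ_{i∈I} v_i ≥ z(I) for all I ⊂ [n] }, (39) where [n] = {1,…,n} and z is a
supermodular boolean function z : 2^[n] → ℝ with z(∅) = 0. In fact every supermodular boolean function, that means z : 2^[n] → ℝ with
z(A) + z(B) ≤ z(A ∩ B) + z(A ∪ B) for all A, B ⊂ [n], gives rise to a generalized permutahedron by the inequality description in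
eq. (39)." · "**Corollary 24.** If both 𝒢_{z₁} and 𝒢_{z₂} are generalized permutahedra and z₁(A) > z₂(A) for all non-empty A ⊊ [n] and
z₁([n]) = z₂([n]), then 𝒢_{z₁} ⊂ relint 𝒢_{z₂}." · "**Lemma 25.** If both 𝒢_{z₁} and 𝒢_{z₂} are generalized permutahedra, then also their
Minkowski sum 𝒢_{z₁₂} = 𝒢_{z₁} + 𝒢_{z₂} is a generalized permutahedron with … z₁₂(A) = z₁(A) + z₂(A) for all A ⊂ [n]." · "A vector
v ∈ 𝒢_z which maximizes all linear functionals in a Weyl chamber C_σ is a vertex of 𝒢_z. This gives a canonical map from permutations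
σ ∈ S_n to the vertices of a generalized permutahedron. We can use a result of Fujishige and Tomizawa to explicitly construct this map:
**Lemma 26** ([Fujishige–Tomizawa 1983, Lemma 3.1, Lemma 3.2]). If z is a supermodular function z : 2^[n] → ℝ, σ ∈ S_n a permutation
and w^{(σ,z)} ∈ ℝⁿ is the vector given component-wise by w^{(σ,z)}_{σ(k)} = z(A^σ_k) − z(A^σ_{k−1}) for all k ∈ [n], (41) where
A^σ_k = {σ(1), …, σ(k)} ⊂ [n] = {1,…,n}, then w^{(σ,z)} is a vertex of the generalized permutahedron 𝒢_z and
⟨y, w^{(σ,z)}⟩ = max_{v∈𝒢_z} ⟨y, v⟩ for all y ∈ C_σ, where C_σ is a Weyl-chamber in the braid arrangement fan as defined in eq. (38)."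
[Used in the proof of Theorem 27 (geometric sector decomposition for generalized permutahedra): "By Lemma 26 we have vertices
w^{(σ,z_𝒜)} ∈ 𝒜 and w^{(σ,z_ℬ)} ∈ ℬ such that ⟨y, w^{(σ,z_𝒜)}⟩ = max_{v∈𝒜} ⟨y, v⟩ … for all σ ∈ S_n and y ∈ C_σ", i.e. on the Hepp
sector C_σ the tropical approximation of a polynomial whose Newton polytope is 𝒢_z is the single monomial x^{w^{(σ,z)}}, whose exponents
telescope along the chain: Σ_{i∈A^σ_k} w_i = z(A^σ_k) — the printed "⟨u^{(σ,k)}, w^{(σ,z_𝒜)}⟩ = −z_𝒜(A^σ_k)" (tex l.1079).]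

TYPING (ground set `[n]` = `Fin n`, 0-indexed: `σ : Equiv.Perm (Fin n)`, chain sets `chainSet σ k = {σ 0, …, σ (k−1)}` = A^σ_k for
`k = 0, …, n`, `chainSet σ 0 = ∅`, `chainSet σ n = univ`): `Supermodular z`; `gpPolytope z` = the right-hand side of (39) — we take the
printed facet presentation AS THE DEFINITION of 𝒢_z (Definition 22's normal-fan formulation and the equivalence asserted by Theorem 23
are not typed); `weylChamber σ` = (38) (as a set of `y : Fin n → ℝ`; the quotient by 𝟙ℝ is immaterial for the inequalities);
`ftVertex z σ` = w^{(σ,z)} of (41) (`ftVertex_apply`). PROVED: the chain-set telescoping `Σ_{i∈A^σ_k} w_i = z(A^σ_k)`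
(`sum_chainSet_ftVertex`, `sum_univ_ftVertex`); **`w^{(σ,z)} ∈ 𝒢_z`** for supermodular `z` with `z(∅) = 0` (`le_sum_ftVertex`: z(I) ≤
Σ_{i∈I} w_i for every I, by induction along the chain using supermodularity at (A^σ_{k−1}, I); `ftVertex_mem_gpPolytope`); **Lemma 26's
maximisation `⟨y, v⟩ ≤ ⟨y, w^{(σ,z)}⟩` for all `v ∈ 𝒢_z`, `y ∈ C_σ`** (`inner_le_inner_ftVertex`, via Abel summation `abel_le` on the
chain); **"w^{(σ,z)} is a vertex of 𝒢_z"** as: `w^{(σ,z)}` is an extreme point of `𝒢_z` (`ftVertex_mem_extremePoints`); the elementary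
halves of Corollary 24 (`gpPolytope_mono`: z₂ ≤ z₁ with z₁([n]) = z₂([n]) ⇒ 𝒢_{z₁} ⊆ 𝒢_{z₂}; the relative-interior refinement is not
typed) and of Lemma 25 (`add_mem_gpPolytope`: 𝒢_{z₁} + 𝒢_{z₂} ⊆ 𝒢_{z₁+z₂}, `supermodular_add`; the reverse inclusion is not typed).
NOT typed: "every generalized permutahedron has this presentation" (Theorem 23 as an equivalence), the continuous part of Theorem 27.
(Filed by the pub-qed literature seat gen 23 for the IR/SE lane's sector-decomposition row — human ruling (a); it is the combinatorial
statement behind "in a cone where every polynomial of the integrand is dominated by ONE monomial" (`irse/IDEAS-subtraction.md` C3) and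
the per-sector exponents r(A^σ_k) of `SectorTableRecursion`; `irse/lit/SECTOR-DECOMP-EXTRACT-lit.md` §3.5. VALUE-FREE. independent
recomputation; certified where stated, statistical where stated; no new-physics claim.)
-/

namespace Literature.MathematicalPhysics.QuantumFieldTheory.Borinsky2020

open Finset

variable {n : ℕ}

/-! ## Theorem 23's objects: supermodular boolean functions and the facet presentation `𝒢_z` -/

/-- "a supermodular boolean function z : 2^[n] → ℝ … that means z(A) + z(B) ≤ z(A ∩ B) + z(A ∪ B) for all A, B ⊂ [n]".
[cite: Borinsky2020, Theorem 23 (tex l.1017–1021)] -/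
def Supermodular (z : Finset (Fin n) → ℝ) : Prop :=
  ∀ A B : Finset (Fin n), z A + z B ≤ z (A ∩ B) + z (A ∪ B)

/-- The facet presentation (39): "𝒢_z = { v ∈ ℝⁿ : Σ_{i∈[n]} v_i = z([n]) and Σ_{i∈I} v_i ≥ z(I) for all I ⊂ [n] }" — taken here as
the definition of `𝒢_z`. [cite: Borinsky2020, Theorem 23 eq. (39) (tex l.1016–1018)] -/
def gpPolytope (z : Finset (Fin n) → ℝ) : Set (Fin n → ℝ) :=
  {v | ∑ i, v i = z univ ∧ ∀ I : Finset (Fin n), z I ≤ ∑ i ∈ I, v i}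

/-- Membership in `𝒢_z`, unfolded. [cite: Borinsky2020, Theorem 23 eq. (39)] -/
theorem mem_gpPolytope {z : Finset (Fin n) → ℝ} {v : Fin n → ℝ} :
    v ∈ gpPolytope z ↔ ∑ i, v i = z univ ∧ ∀ I : Finset (Fin n), z I ≤ ∑ i ∈ I, v i := Iff.rfl

/-- Corollary 24, inclusion part: if `z₂ ≤ z₁` on all subsets and `z₁([n]) = z₂([n])` then `𝒢_{z₁} ⊆ 𝒢_{z₂}` (the printed statement
has strict inequalities on non-empty proper subsets and concludes `𝒢_{z₁} ⊂ relint 𝒢_{z₂}`; the relative interior is not typed).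
[cite: Borinsky2020, Corollary 24 (tex l.1024–1033)] -/
theorem gpPolytope_mono {z₁ z₂ : Finset (Fin n) → ℝ} (h : ∀ I, z₂ I ≤ z₁ I) (htop : z₁ univ = z₂ univ) :
    gpPolytope z₁ ⊆ gpPolytope z₂ := by
  intro v hv
  exact ⟨hv.1.trans htop, fun I => (h I).trans (hv.2 I)⟩

/-- Lemma 25, elementary half: `𝒢_{z₁} + 𝒢_{z₂} ⊆ 𝒢_{z₁ + z₂}` (the printed lemma is the equality of the Minkowski sum with
`𝒢_{z₁₂}`, `z₁₂ = z₁ + z₂`; the reverse inclusion is not typed). [cite: Borinsky2020, Lemma 25 (tex l.1035–1039)] -/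
theorem add_mem_gpPolytope {z₁ z₂ : Finset (Fin n) → ℝ} {v₁ v₂ : Fin n → ℝ} (h₁ : v₁ ∈ gpPolytope z₁)
    (h₂ : v₂ ∈ gpPolytope z₂) : v₁ + v₂ ∈ gpPolytope (z₁ + z₂) := by
  refine ⟨?_, fun I => ?_⟩
  · simp only [Pi.add_apply, sum_add_distrib, h₁.1, h₂.1]
  · simp only [Pi.add_apply, sum_add_distrib]
    exact add_le_add (h₁.2 I) (h₂.2 I)

/-- `z₁ + z₂` is supermodular when `z₁`, `z₂` are (the boolean function of the Minkowski sum in Lemma 25).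
[cite: Borinsky2020, Lemma 25 (tex l.1035–1039)] -/
theorem supermodular_add {z₁ z₂ : Finset (Fin n) → ℝ} (h₁ : Supermodular z₁) (h₂ : Supermodular z₂) :
    Supermodular (z₁ + z₂) := by
  intro A B
  simp only [Pi.add_apply]
  linarith [h₁ A B, h₂ A B]

/-! ## Weyl chambers (38) and the chain sets `A^σ_k` -/

/-- The Weyl chamber (38): "C_σ = { y : y_{σ(1)} ≤ … ≤ y_{σ(n)} }" (as a set of functions on `[n]`; the quotient by `𝟙ℝ` plays no
role in the inequalities below). [cite: Borinsky2020, eq. (38) (tex l.1004–1006)] -/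
def weylChamber (σ : Equiv.Perm (Fin n)) : Set (Fin n → ℝ) :=
  {y | ∀ j j' : Fin n, j ≤ j' → y (σ j) ≤ y (σ j')}

/-- The chain set "A^σ_k = {σ(1), …, σ(k)}" (0-indexed: the images under `σ` of the positions `< k`; `k = 0, …, n`).
[cite: Borinsky2020, Lemma 26 (tex l.1049)] -/
def chainSet (σ : Equiv.Perm (Fin n)) (k : ℕ) : Finset (Fin n) :=
  univ.filter fun i => ((σ.symm i : Fin n) : ℕ) < k

/-- `i ∈ A^σ_k ↔ σ⁻¹(i) < k` (0-indexed positions). Plumbing for the printed chain sets. [cite: Borinsky2020, Lemma 26 (tex l.1049)] -/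
theorem mem_chainSet {σ : Equiv.Perm (Fin n)} {k : ℕ} {i : Fin n} :
    i ∈ chainSet σ k ↔ ((σ.symm i : Fin n) : ℕ) < k := by
  simp [chainSet]

/-- `σ(j) ∈ A^σ_k ↔ j < k` (0-indexed positions). Plumbing for the printed chain sets. [cite: Borinsky2020, Lemma 26 (tex l.1049)] -/
@[simp] theorem apply_mem_chainSet {σ : Equiv.Perm (Fin n)} {k : ℕ} {j : Fin n} :
    σ j ∈ chainSet σ k ↔ (j : ℕ) < k := by
  simp [chainSet]

/-- `A^σ_0 = ∅`. [cite: Borinsky2020, Lemma 26 (tex l.1049)] -/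
theorem chainSet_zero (σ : Equiv.Perm (Fin n)) : chainSet σ 0 = ∅ := by
  ext i
  simp [chainSet]

/-- `A^σ_n = [n]` (and `A^σ_k = [n]` for every `k ≥ n`). [cite: Borinsky2020, Lemma 26 (tex l.1049)] -/
theorem chainSet_of_le (σ : Equiv.Perm (Fin n)) {k : ℕ} (hk : n ≤ k) : chainSet σ k = univ := by
  ext i
  simp only [mem_chainSet, mem_univ, iff_true]
  exact lt_of_lt_of_le (σ.symm i).isLt hk

/-- `A^σ_{k+1} = A^σ_k ∪ {σ(k+1)}` (0-indexed: insert `σ k`). [cite: Borinsky2020, Lemma 26 (tex l.1049)] -/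
theorem chainSet_succ (σ : Equiv.Perm (Fin n)) {k : ℕ} (hk : k < n) :
    chainSet σ (k + 1) = insert (σ ⟨k, hk⟩) (chainSet σ k) := by
  ext i
  simp only [mem_chainSet, mem_insert]
  constructor
  · intro h
    rcases lt_or_eq_of_le (Nat.lt_succ_iff.mp h) with h | h
    · exact Or.inr h
    · left
      have hs : σ.symm i = ⟨k, hk⟩ := Fin.ext h
      rw [← hs, Equiv.apply_symm_apply]
  · rintro (h | h)
    · subst h
      simp
    · exact Nat.lt_succ_of_lt h

/-- `σ(k+1) ∉ A^σ_k` (0-indexed: `σ k ∉ chainSet σ k`). Plumbing for the printed chain sets. [cite: Borinsky2020, Lemma 26 (tex l.1049)] -/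
theorem apply_not_mem_chainSet (σ : Equiv.Perm (Fin n)) {k : ℕ} (hk : k < n) : σ ⟨k, hk⟩ ∉ chainSet σ k := by
  simp

/-- Reading a function on `[n]` along the chain: position `m ↦ f(σ(m+1))` (0-indexed `f (σ m)`), extended by `0` beyond `n`.
Elementary plumbing for the range sums below. [cite: Borinsky2020, Lemma 26 (tex l.1049)] -/
def alongChain (σ : Equiv.Perm (Fin n)) (f : Fin n → ℝ) (m : ℕ) : ℝ :=
  if h : m < n then f (σ ⟨m, h⟩) else 0

/-- `alongChain σ f m = f (σ m)` for `m < n`. Plumbing. [cite: Borinsky2020, Lemma 26 (tex l.1049)] -/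
theorem alongChain_of_lt (σ : Equiv.Perm (Fin n)) (f : Fin n → ℝ) {m : ℕ} (hm : m < n) :
    alongChain σ f m = f (σ ⟨m, hm⟩) := by
  simp [alongChain, hm]

/-- Reading a pointwise product along the chain. Plumbing. [cite: Borinsky2020, Lemma 26 (tex l.1049)] -/
theorem alongChain_mul (σ : Equiv.Perm (Fin n)) (f g : Fin n → ℝ) (m : ℕ) :
    alongChain σ (fun i => f i * g i) m = alongChain σ f m * alongChain σ g m := by
  unfold alongChain
  split_ifs <;> simp

/-- `Σ_{i ∈ A^σ_k} f_i = Σ_{m < k} f(σ(m))` for `k ≤ n`. [cite: Borinsky2020, Lemma 26 (tex l.1049)] -/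
theorem sum_chainSet_eq_sum_range (σ : Equiv.Perm (Fin n)) (f : Fin n → ℝ) {k : ℕ} (hk : k ≤ n) :
    ∑ i ∈ chainSet σ k, f i = ∑ m ∈ range k, alongChain σ f m := by
  induction k with
  | zero => simp [chainSet_zero]
  | succ k ih =>
    have hk' : k < n := hk
    rw [chainSet_succ σ hk', sum_insert (apply_not_mem_chainSet σ hk'), ih hk'.le, sum_range_succ,
      alongChain_of_lt σ f hk', add_comm]

/-- `Σ_{i∈[n]} f_i = Σ_{m < n} f(σ(m))` (the case `A^σ_n = [n]`). Plumbing. [cite: Borinsky2020, Lemma 26 (tex l.1049)] -/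
theorem sum_univ_eq_sum_range (σ : Equiv.Perm (Fin n)) (f : Fin n → ℝ) :
    ∑ i, f i = ∑ m ∈ range n, alongChain σ f m := by
  rw [← chainSet_of_le σ le_rfl]
  exact sum_chainSet_eq_sum_range σ f le_rfl

/-! ## Lemma 26: the Fujishige–Tomizawa vertex `w^{(σ,z)}` -/

/-- "(41) w^{(σ,z)}_{σ(k)} = z(A^σ_k) − z(A^σ_{k−1}) for all k ∈ [n]" (0-indexed: `w (σ j) = z(A^σ_{j+1}) − z(A^σ_j)`).
[cite: Borinsky2020, Lemma 26 eq. (41) (tex l.1045–1049)] -/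
def ftVertex (z : Finset (Fin n) → ℝ) (σ : Equiv.Perm (Fin n)) (i : Fin n) : ℝ :=
  z (chainSet σ (((σ.symm i : Fin n) : ℕ) + 1)) - z (chainSet σ ((σ.symm i : Fin n) : ℕ))

/-- (41) at `σ(k)`: `w^{(σ,z)}_{σ(k)} = z(A^σ_k) − z(A^σ_{k−1})` (0-indexed). [cite: Borinsky2020, Lemma 26 eq. (41)] -/
theorem ftVertex_apply (z : Finset (Fin n) → ℝ) (σ : Equiv.Perm (Fin n)) (j : Fin n) :
    ftVertex z σ (σ j) = z (chainSet σ ((j : ℕ) + 1)) - z (chainSet σ (j : ℕ)) := by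
  simp [ftVertex]

/-- (41) read along the chain: position `m` carries `z(A^σ_{m+1}) − z(A^σ_m)`. [cite: Borinsky2020, Lemma 26 eq. (41)] -/
theorem alongChain_ftVertex (z : Finset (Fin n) → ℝ) (σ : Equiv.Perm (Fin n)) {m : ℕ} (hm : m < n) :
    alongChain σ (ftVertex z σ) m = z (chainSet σ (m + 1)) - z (chainSet σ m) := by
  rw [alongChain_of_lt σ _ hm, ftVertex_apply]

/-- The exponents telescope along the chain: `Σ_{i ∈ A^σ_k} w^{(σ,z)}_i = z(A^σ_k)` for `z(∅) = 0`, `k ≤ n` (the printed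
"⟨u^{(σ,k)}, w^{(σ,z)}⟩ = −z(A^σ_k)" of the proof of Theorem 27, tex l.1079, up to the sign of the generator u^{(σ,k)}).
[cite: Borinsky2020, Lemma 26 / proof of Theorem 27 (tex l.1045–1049, l.1079)] -/
theorem sum_chainSet_ftVertex (z : Finset (Fin n) → ℝ) (σ : Equiv.Perm (Fin n)) (h0 : z ∅ = 0) {k : ℕ} (hk : k ≤ n) :
    ∑ i ∈ chainSet σ k, ftVertex z σ i = z (chainSet σ k) := by
  rw [sum_chainSet_eq_sum_range σ _ hk]
  have hc : ∀ m ∈ range k, alongChain σ (ftVertex z σ) m = z (chainSet σ (m + 1)) - z (chainSet σ m) := by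
    intro m hm
    exact alongChain_ftVertex z σ (lt_of_lt_of_le (mem_range.mp hm) hk)
  rw [sum_congr rfl hc, Finset.sum_range_sub (fun m => z (chainSet σ m)), chainSet_zero, h0, sub_zero]

/-- In particular `Σ_{i∈[n]} w^{(σ,z)}_i = z([n])` — the equality constraint of (39). [cite: Borinsky2020, Lemma 26, Theorem 23 eq. (39)] -/
theorem sum_univ_ftVertex (z : Finset (Fin n) → ℝ) (σ : Equiv.Perm (Fin n)) (h0 : z ∅ = 0) :
    ∑ i, ftVertex z σ i = z univ := by
  rw [← chainSet_of_le σ le_rfl]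
  exact sum_chainSet_ftVertex z σ h0 le_rfl

/-- **`w^{(σ,z)}` satisfies every facet inequality of (39)**: `z(I) ≤ Σ_{i∈I} w^{(σ,z)}_i` for all `I ⊂ [n]`, for supermodular `z`
with `z(∅) = 0`. (Induction along the chain: for `I ⊆ A^σ_k ∪ {e}`, `e = σ(k+1) ∈ I`, supermodularity at `(A^σ_k, I)` reads
`z(A^σ_k) + z(I) ≤ z(I ∖ e) + z(A^σ_{k+1})`.) [cite: Borinsky2020, Lemma 26 (tex l.1043–1057)] -/
theorem le_sum_ftVertex {z : Finset (Fin n) → ℝ} (hz : Supermodular z) (h0 : z ∅ = 0) (σ : Equiv.Perm (Fin n))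
    (I : Finset (Fin n)) : z I ≤ ∑ i ∈ I, ftVertex z σ i := by
  suffices H : ∀ k, k ≤ n → ∀ I, I ⊆ chainSet σ k → z I ≤ ∑ i ∈ I, ftVertex z σ i from
    H n le_rfl I (by rw [chainSet_of_le σ le_rfl]; exact subset_univ I)
  intro k
  induction k with
  | zero =>
    intro _ I hI
    rw [chainSet_zero, subset_empty] at hI
    subst hI
    simp [h0]
  | succ k ih =>
    intro hk I hI
    have hk' : k < n := hk
    by_cases hmem : σ ⟨k, hk'⟩ ∈ I
    · have hI' : I.erase (σ ⟨k, hk'⟩) ⊆ chainSet σ k := by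
        intro i hi
        rw [mem_erase] at hi
        have h2 := hI hi.2
        rw [chainSet_succ σ hk', mem_insert] at h2
        exact h2.resolve_left hi.1
      have hsum : ∑ i ∈ I, ftVertex z σ i
          = ftVertex z σ (σ ⟨k, hk'⟩) + ∑ i ∈ I.erase (σ ⟨k, hk'⟩), ftVertex z σ i :=
        (add_sum_erase I _ hmem).symm
      have hinter : chainSet σ k ∩ I = I.erase (σ ⟨k, hk'⟩) := by
        ext i
        simp only [mem_inter, mem_erase]
        constructor
        · rintro ⟨h1, h2⟩
          refine ⟨?_, h2⟩
          rintro rfl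
          exact apply_not_mem_chainSet σ hk' h1
        · rintro ⟨h1, h2⟩
          exact ⟨hI' (mem_erase.mpr ⟨h1, h2⟩), h2⟩
      have hunion : chainSet σ k ∪ I = chainSet σ (k + 1) := by
        rw [chainSet_succ σ hk']
        ext i
        simp only [mem_union, mem_insert]
        constructor
        · rintro (h | h)
          · exact Or.inr h
          · have h2 := hI h
            rw [chainSet_succ σ hk', mem_insert] at h2
            exact h2
        · rintro (h | h)
          · exact Or.inr (h ▸ hmem)
          · exact Or.inl h
      have hsup := hz (chainSet σ k) I
      rw [hinter, hunion] at hsup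
      have hih := ih hk'.le (I.erase (σ ⟨k, hk'⟩)) hI'
      rw [hsum, ftVertex_apply]
      linarith
    · refine ih hk'.le I (fun i hi => ?_)
      have h2 := hI hi
      rw [chainSet_succ σ hk', mem_insert] at h2
      rcases h2 with h | h
      · exact absurd (h ▸ hi) hmem
      · exact h

/-- **Lemma 26, membership**: `w^{(σ,z)} ∈ 𝒢_z` for supermodular `z` with `z(∅) = 0`. [cite: Borinsky2020, Lemma 26 (tex l.1043–1057)] -/
theorem ftVertex_mem_gpPolytope {z : Finset (Fin n) → ℝ} (hz : Supermodular z) (h0 : z ∅ = 0) (σ : Equiv.Perm (Fin n)) :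
    ftVertex z σ ∈ gpPolytope z :=
  ⟨sum_univ_ftVertex z σ h0, fun I => le_sum_ftVertex hz h0 σ I⟩

/-- Abel summation in inequality form (the mechanism of Lemma 26's maximisation): if `Y` is non-decreasing on `{0,…,n−1}`, the totals
of `V` and `W` over `range n` agree and every partial sum of `W` is at most that of `V`, then `Σ Y·V ≤ Σ Y·W`. Elementary
(Mathlib's `Finset.sum_range_by_parts`). [cite: Borinsky2020, Lemma 26 (tex l.1043–1057)] -/
theorem abel_le (Y V W : ℕ → ℝ) (n : ℕ) (hY : ∀ m, m + 1 < n → Y m ≤ Y (m + 1))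
    (htot : ∑ m ∈ range n, V m = ∑ m ∈ range n, W m)
    (hpart : ∀ k, k ≤ n → ∑ m ∈ range k, W m ≤ ∑ m ∈ range k, V m) :
    ∑ m ∈ range n, Y m * V m ≤ ∑ m ∈ range n, Y m * W m := by
  have hV := Finset.sum_range_by_parts Y V n
  have hW := Finset.sum_range_by_parts Y W n
  simp only [smul_eq_mul] at hV hW
  rw [hV, hW, htot]
  apply sub_le_sub_left
  apply sum_le_sum
  intro i hi
  have hi' : i + 1 < n := by
    have := mem_range.mp hi
    omega
  exact mul_le_mul_of_nonneg_left (hpart (i + 1) hi'.le) (sub_nonneg.mpr (hY i hi'))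

/-- **Lemma 26, maximisation**: "⟨y, w^{(σ,z)}⟩ = max_{v∈𝒢_z} ⟨y, v⟩ for all y ∈ C_σ" — for `z` with `z(∅) = 0`, every `y` in the
Weyl chamber `C_σ` and every `v ∈ 𝒢_z`: `Σ_i y_i v_i ≤ Σ_i y_i w^{(σ,z)}_i` (this inequality needs only the constraints (39) on `v` and
the telescoping of `w^{(σ,z)}`; supermodularity is what puts `w^{(σ,z)}` itself in `𝒢_z`, `ftVertex_mem_gpPolytope`, so that the bound
is attained). [cite: Borinsky2020, Lemma 26 (tex l.1043–1057)] -/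
theorem inner_le_inner_ftVertex {z : Finset (Fin n) → ℝ} (h0 : z ∅ = 0) (σ : Equiv.Perm (Fin n))
    {y : Fin n → ℝ} (hy : y ∈ weylChamber σ) {v : Fin n → ℝ} (hv : v ∈ gpPolytope z) :
    ∑ i, y i * v i ≤ ∑ i, y i * ftVertex z σ i := by
  rw [sum_univ_eq_sum_range σ (fun i => y i * v i), sum_univ_eq_sum_range σ (fun i => y i * ftVertex z σ i)]
  simp only [alongChain_mul]
  apply abel_le
  · intro m hm
    have hm' : m < n := by omega
    rw [alongChain_of_lt σ y hm', alongChain_of_lt σ y hm]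
    exact hy _ _ (Fin.mk_le_mk.mpr (Nat.le_succ m))
  · rw [← sum_univ_eq_sum_range, ← sum_univ_eq_sum_range, hv.1, sum_univ_ftVertex z σ h0]
  · intro k hk
    rw [← sum_chainSet_eq_sum_range σ _ hk, ← sum_chainSet_eq_sum_range σ _ hk, sum_chainSet_ftVertex z σ h0 hk]
    exact hv.2 _

/-- A point of `𝒢_z` whose chain-set sums all equal `z(A^σ_k)` IS `w^{(σ,z)}` (each coordinate is a difference of consecutive
chain sums). [cite: Borinsky2020, Lemma 26 (tex l.1043–1057)] -/
theorem eq_ftVertex_of_sum_chainSet_eq {z : Finset (Fin n) → ℝ} (σ : Equiv.Perm (Fin n)) {v : Fin n → ℝ}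
    (hv : ∀ k, k ≤ n → ∑ i ∈ chainSet σ k, v i = z (chainSet σ k)) : v = ftVertex z σ := by
  funext i
  obtain ⟨j, rfl⟩ : ∃ j, σ j = i := ⟨σ.symm i, σ.apply_symm_apply i⟩
  have hj : (j : ℕ) < n := j.isLt
  have hsplit : ∑ i ∈ chainSet σ ((j : ℕ) + 1), v i = v (σ ⟨(j : ℕ), hj⟩) + ∑ i ∈ chainSet σ (j : ℕ), v i := by
    rw [chainSet_succ σ hj, sum_insert (apply_not_mem_chainSet σ hj)]
  have hsucc := hv ((j : ℕ) + 1) hj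
  rw [hsplit, hv (j : ℕ) hj.le] at hsucc
  rw [ftVertex_apply]
  have hmk : σ ⟨(j : ℕ), hj⟩ = σ j := by simp
  rw [hmk] at hsucc
  linarith

/-- **Lemma 26, vertex**: "w^{(σ,z)} is a vertex of the generalized permutahedron 𝒢_z" — typed as: `w^{(σ,z)}` is an extreme point of
`𝒢_z` (if `w^{(σ,z)}` lies on an open segment between `v₁, v₂ ∈ 𝒢_z`, the tight chain inequalities force `v₁ = v₂ = w^{(σ,z)}`).
[cite: Borinsky2020, Lemma 26 (tex l.1041–1057)] -/
theorem ftVertex_mem_extremePoints {z : Finset (Fin n) → ℝ} (hz : Supermodular z) (h0 : z ∅ = 0) (σ : Equiv.Perm (Fin n)) :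
    ftVertex z σ ∈ (gpPolytope z).extremePoints ℝ := by
  refine ⟨ftVertex_mem_gpPolytope hz h0 σ, ?_⟩
  intro v₁ hv₁ v₂ hv₂ hseg
  obtain ⟨a, b, ha, hb, hab, hcomb⟩ := hseg
  -- the chain sums of v₁ and v₂ are tight
  have tight : ∀ k, k ≤ n →
      (∑ i ∈ chainSet σ k, v₁ i = z (chainSet σ k)) ∧ (∑ i ∈ chainSet σ k, v₂ i = z (chainSet σ k)) := by
    intro k hk
    have h1 := hv₁.2 (chainSet σ k)
    have h2 := hv₂.2 (chainSet σ k)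
    have hw := sum_chainSet_ftVertex z σ h0 hk
    have hc : ∑ i ∈ chainSet σ k, ftVertex z σ i
        = a * ∑ i ∈ chainSet σ k, v₁ i + b * ∑ i ∈ chainSet σ k, v₂ i := by
      rw [← hcomb, mul_sum, mul_sum, ← sum_add_distrib]
      rfl
    rw [hw] at hc
    have key : a * (∑ i ∈ chainSet σ k, v₁ i - z (chainSet σ k))
        + b * (∑ i ∈ chainSet σ k, v₂ i - z (chainSet σ k)) = 0 := by
      linear_combination (-1 : ℝ) * hc - z (chainSet σ k) * hab
    have hp1 : 0 ≤ a * (∑ i ∈ chainSet σ k, v₁ i - z (chainSet σ k)) := mul_nonneg ha.le (sub_nonneg.mpr h1)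
    have hp2 : 0 ≤ b * (∑ i ∈ chainSet σ k, v₂ i - z (chainSet σ k)) := mul_nonneg hb.le (sub_nonneg.mpr h2)
    have hz1 : a * (∑ i ∈ chainSet σ k, v₁ i - z (chainSet σ k)) = 0 := by linarith
    have hz2 : b * (∑ i ∈ chainSet σ k, v₂ i - z (chainSet σ k)) = 0 := by linarith
    rcases mul_eq_zero.mp hz1 with h | h
    · exact absurd h ha.ne'
    rcases mul_eq_zero.mp hz2 with h' | h'
    · exact absurd h' hb.ne'
    exact ⟨(sub_eq_zero.mp h), (sub_eq_zero.mp h')⟩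
  exact eq_ftVertex_of_sum_chainSet_eq σ (fun k hk => (tight k hk).1)

end Literature.MathematicalPhysics.QuantumFieldTheory.Borinsky2020
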